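import Mathlib
import HarnessLib

/-!
# Anderson–Kruczenski, *Loop equations and bootstrap methods in the lattice* (Nucl. Phys. B 921 (2017) 702–726,
# arXiv:1612.08140): the large-`N` PLAQUETTE LOOP EQUATION and the ANALYTIC PLAQUETTE BOUNDS that follow from it
# and `3 × 3` Gram positivity (§4.2–§4.3) — typed as finite real-algebra statements, every implication PROVED

**Source.** P. D. Anderson, M. Kruczenski, *Loop equations and bootstrap methods in the lattice*, Nucl. Phys. B
**921** (2017) 702–726, doi:10.1016/j.nuclphysb.2017.06.009, arXiv:1612.08140 [AndersonKruczenski2017].  Equation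
labels `(aNN)` below are the `\label`s of the arXiv TeX source (held as `paper:arxiv-1612.08140`), as used by the
tree's gauge-bootstrap tribunal record (`run/shared/lean/pub/pub-gaugeboot/tribunal/t2.md` §2 row 6).

**What the paper prints (verbatim, TeX extraction).**  §2.1: *"The action is the Wilson action
`S = −(N/2λ) Σ_P tr U_P` where the sum is over all oriented plaquettes"* (so the standard Wilson coupling is
`β = N²/λ`).  §2.2, after the large-`N` loop equation (a22) (*"used the large N factorization property
`N⁻²⟨W{C₁}W{C₂}⟩ = 𝒲{C₁}𝒲{C₂} + 𝒪(1/N²)`"*): *"For example, for the plaquette we get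
`−𝒲₀ − 𝒲₂ − 4𝒲₃ + 𝒲₁₇ + 𝒲₂₀ + 4𝒲₂₁ + 2λ𝒲₁ = 0`"* (`d = 4`, `𝒲₀ = 1`, `𝒲₁ = u` the plaquette).  §4.2
(positivity, (a63)–(a67)): for open lines `𝒞_ℓ` from `x₁` to `x₂` and `A = Σ_ℓ c_ℓ U^{(ℓ)}`, *"since `tr A†A ≥ 0` …
the matrix of Wilson loop expectation values `ρ_{ℓℓ'} = ⟨tr[(U^{(ℓ)})† U^{(ℓ')}]⟩/N` is positive semi-definite for
any set of open loops and any two points"*; in particular (a64) `ρ = [[1, 𝒲_a, 𝒲_b],[𝒲_a, 1, 𝒲_c],[𝒲_b, 𝒲_c, 1]]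
⪰ 0 ⇒ 0 ≤ (𝒲_a − 𝒲_b)² ≤ (1 − 𝒲_c)(1 + 𝒲_c − 2𝒲_a𝒲_b)`; (a66) for a loop `a` *"made out of two plaquettes
connected by a long path"*, `𝒲_a ≥ 2u² − 1`; (a67) `[[1, u],[u, 1]] ⪰ 0 ⇒ |u|² ≤ 1`.  §4.3 (a68)–(a71): *"the loop
equation for the plaquette in dimension `d ≥ 3` … is `2λu = 1 + 𝒲₂ + 2(d−2)𝒲₃ − 𝒲₂₀ − 𝒲₁₇ − 2(d−2)𝒲₂₁`.  If we
want to maximize `u`, we set `𝒲₂ = 𝒲₃ = 1`, their maximum values and `𝒲₂₀ = 𝒲₁₇ = 𝒲₂₁ = 2u² − 1` their minimum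
values according to the previous subsection … `u² + λu/(2(d−1)) − 1 = 0`.  One of the roots of this equation gives
the upper bound, namely `u ≤ ½(−λ/(2(d−1)) + √(4 + λ²/(4(d−1)²))) = u_max`, a bound valid for the Wilson action in
a cubic lattice of any dimension `d ≥ 3` … Similarly we can get a lower bound by choosing `𝒲₂ = 𝒲₃ = 2u² − 1`, and
`𝒲₂₀ = 𝒲₁₇ = 𝒲₂₁ = 1`:  `u ≥ ½(λ/(2d−3) − √(4 + (λ/(2d−3))²)) = u_min`."*

**Loop labels** (AK Fig. `fig:WL`, read off the structure of the single-link Schwinger–Dyson equation): in the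
plaquette equation the marked link of the plaquette `P` is shared with `2(d−1)` oriented plaquettes `P'`; joining
`P` with `P'` of compatible orientation deletes the link — `𝒲₂` = the planar `1 × 2` rectangle (in-plane
neighbour), `𝒲₃` = the bent ("chair") double plaquette (`2(d−2)` out-of-plane neighbours); joining with the
opposite orientation traverses the link twice — `𝒲₂₀` (in-plane), `𝒲₂₁` (out-of-plane), and `𝒲₁₇` = the doubly
wound plaquette (`P' = P`); `P' = P̄` gives the trivial loop `𝒲₀ = 1`.

**What this file types (and proves).**  Everything is elementary real algebra about real numbers standing for
the `N = ∞` loop values; no measure, no limit, no gauge theory is constructed here.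
* §1 `thooftCoupling` (`λ = N²/β_std`), the printed strong-coupling comparator series (a5) `strongCouplingPlaquetteSeries`.
* §2 the plaquette loop equation (a68) as a `Prop`-valued definition `PlaquetteLoopEq d λ u 𝒲₂ 𝒲₃ 𝒲₁₇ 𝒲₂₀ 𝒲₂₁`,
  with its `d = 4` form of §2.2 (`plaquetteLoopEq_four_iff`).
* §3 the Gram matrices `gram2 u = [[1,u],[u,1]]`, `gram3 a b c = [[1,a,b],[a,1,c],[b,c,1]]` and the PROVED
  consequences of their positive semi-definiteness: (a67) `abs_le_one_of_gram2`; (a64) `sq_sub_le_of_gram3` (via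
  `det ≥ 0`, `gram3_det`); (a66) `two_mul_sq_sub_one_le_of_gram3` (test vector `(2u, −1, −1)`); `le_one_of_gram3`.
* §4 the printed closed forms `uMax d λ` (a70), `uMin d λ` (a71) and the two bounds PROVED as finite implications:
  `plaquette_le_uMax` / `uMin_le_plaquette` (hypotheses: (a68) and the five scalar inequalities AK substitute), and
  the Gram-packaged forms `plaquette_le_uMax_of_gram` / `uMin_le_plaquette_of_gram` (hypotheses: (a68) and
  positivity of the five `ρ`-matrices AK invoke); `d = 4` instances `uMax_four`, `uMin_four`; sanity
  `uMax_pos`, `uMax_lt_one`, `uMin_neg` (the printed lower bound is negative — AK: *"a correct but rather poor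
  bound"* is said of the SDP value `u_min = 0` at `L_max = 8, 10`; the analytic (a71) is weaker still).
  The algebra holds for every `d ≥ 2` (AK state `d ≥ 3`; at `d = 2` the out-of-plane terms are absent).

**HONEST FRAMING / what is NOT here.**  (i) The objects `u, 𝒲ᵢ` of [AndersonKruczenski2017] are `N → ∞` limits of
`SU(N)` Wilson-loop expectations ASSUMED to exist and to factorize (AK eq. after (a20)); neither the limit nor the
factorization is asserted anywhere in this file (both are open in general at weak coupling), so NO statement here is
a statement about a lattice gauge measure.  What IS unconditional: every real tuple satisfying the plaquette loop
equation and the listed positivity constraints obeys `u_min ≤ u ≤ u_max` — exactly the sense in which the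
loop-equation∕positivity bootstrap produces bounds (*"all solutions of the truncated factorized system"*, tribunal
t2.md G1).  (ii) The FINITE-`N` single-link loop equation on the torus `(ℤ/L)^d` is an unconditional THEOREM of the
tree (`Summit.QuantumFields.GaugeBoot.loopEquation_specialUnitaryGroup`, file `Summits/QuantumFields/GaugeBoot/
LoopEquation.lean`; rows-as-data `KZL2D4SDRows*`, `GLYZ*`), as are the reflection-positivity Gram inequalities for
Wilson loops (`Literature.MathematicalPhysics.QuantumFieldTheory.WilsonLoopRP.gram_wilsonLoop_nonneg_site/_link`);
this file does not restate them.  (iii) AK's numerical SDP bounds (§4.4–4.6, `L_max ≤ 14`, cvx∕sdpa, floating point;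
e.g. `w₁ ≥ 0.2495` at `L = 14` vs the exact `¼`) and the 2D Gross–Witten calibration (§3) are not typed.  (iv) No
claim about `N → ∞`, `a → 0`, confinement or a mass gap is made or implied.  Zero named facts (`def … : Prop`
awaiting proof) are introduced: the only `Prop`-valued definition is the hypothesis shape `PlaquetteLoopEq`.

Consumer: the YM instrument cell crew (a) (`run/shared/lean/pub/ym-instrument/`, Q-A1∕Q-A2) — the analytic
`N = ∞` envelope against which certified finite-`N` plaquette windows are compared; R141 (D) item (11).
-/

noncomputable section

open Real Matrix

namespace Literature.MathematicalPhysics.QuantumFieldTheory.AndersonKruczenski2017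

/-! ## §1. Coupling dictionary and the printed comparator series -/

/-- AK's lattice 't Hooft coupling in terms of the standard Wilson coupling: the action is printed as
`S = −(N/2λ) Σ_{oriented P} tr U_P = −(N/λ) Σ_P Re tr U_P`, while the standard Wilson weight is
`exp((β/N) Σ_P Re tr U_P)`; matching gives `β/N = N/λ`, i.e. `λ = N²/β`.
[cite: AndersonKruczenski2017, §2.1 (the Wilson action display, TeX label (a1))] -/
def thooftCoupling (N : ℕ) (β : ℝ) : ℝ := (N : ℝ) ^ 2 / β

/-- `λ = N²/β` unfolded. [cite: AndersonKruczenski2017, §2.1 (TeX label (a1))] -/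
theorem thooftCoupling_def (N : ℕ) (β : ℝ) : thooftCoupling N β = (N : ℝ) ^ 2 / β := rfl

/-- The PRINTED large-`N` strong-coupling series for the `d = 4` plaquette (a comparator, as printed — not a theorem
about any measure): *"`𝒲₁ = u = 1/(2λ) + 1/(8λ⁵) + 15/(128λ⁹) + 17/(256λ¹¹) + 273/(2048λ¹³) + 185/(1024λ¹⁵) + …`"*.
[cite: AndersonKruczenski2017, §2.1.1 eq. (a5)] -/
def strongCouplingPlaquetteSeries (lam : ℝ) : ℝ :=
  1 / (2 * lam) + 1 / (8 * lam ^ 5) + 15 / (128 * lam ^ 9) + 17 / (256 * lam ^ 11) + 273 / (2048 * lam ^ 13)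
    + 185 / (1024 * lam ^ 15)

/-! ## §2. The plaquette loop equation at `N = ∞` -/

/-- **The large-`N` loop equation of the plaquette in dimension `d`** (hypothesis shape; nothing asserted):
*"`2λu = 1 + 𝒲₂ + 2(d−2)𝒲₃ − 𝒲₂₀ − 𝒲₁₇ − 2(d−2)𝒲₂₁`"*, where `u = 𝒲₁` is the plaquette, `𝒲₂` the planar `1×2`
rectangle, `𝒲₃` the bent double plaquette, `𝒲₁₇` the doubly wound plaquette and `𝒲₂₀`, `𝒲₂₁` the in-plane ∕
out-of-plane double plaquettes traversing the shared link twice (AK Fig. WL).  The real arguments stand for `N = ∞`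
loop values; the equation presupposes large-`N` factorization (AK eq. after (a20)), which is NOT asserted here.
[cite: AndersonKruczenski2017, §4.3 eq. (a68); §2.2 (the plaquette example after (a22))] -/
def PlaquetteLoopEq (d : ℕ) (lam u W₂ W₃ W₁₇ W₂₀ W₂₁ : ℝ) : Prop :=
  2 * lam * u = 1 + W₂ + 2 * ((d : ℝ) - 2) * W₃ - W₂₀ - W₁₇ - 2 * ((d : ℝ) - 2) * W₂₁

/-- At `d = 4` the plaquette loop equation is the printed §2.2 example
*"`−𝒲₀ − 𝒲₂ − 4𝒲₃ + 𝒲₁₇ + 𝒲₂₀ + 4𝒲₂₁ + 2λ𝒲₁ = 0`"* with `𝒲₀ = 1`, `𝒲₁ = u`.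
[cite: AndersonKruczenski2017, §2.2 (the plaquette example after (a22)); §4.3 eq. (a68)] -/
theorem plaquetteLoopEq_four_iff (lam u W₂ W₃ W₁₇ W₂₀ W₂₁ : ℝ) :
    PlaquetteLoopEq 4 lam u W₂ W₃ W₁₇ W₂₀ W₂₁ ↔
      -1 - W₂ - 4 * W₃ + W₁₇ + W₂₀ + 4 * W₂₁ + 2 * lam * u = 0 := by
  unfold PlaquetteLoopEq
  norm_num
  constructor <;> intro h <;> linarith

/-! ## §3. Gram (`ρ`-matrix) positivity and its printed consequences -/

/-- The `2 × 2` `ρ`-matrix of the two open lines {trivial, `𝒞`} based at a point: `[[1, u],[u, 1]]` with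
`u = 𝒲_𝒞`. [cite: AndersonKruczenski2017, §4.2 eq. (a67)] -/
def gram2 (u : ℝ) : Matrix (Fin 2) (Fin 2) ℝ := !![1, u; u, 1]

/-- The `3 × 3` `ρ`-matrix of three open lines based at a common point with pairwise loop values `a, b, c`:
`[[1, a, b],[a, 1, c],[b, c, 1]]` (AK: `a, b` two loops sharing their first link, `c` their "intersection").
[cite: AndersonKruczenski2017, §4.2 eq. (a64)] -/
def gram3 (a b c : ℝ) : Matrix (Fin 3) (Fin 3) ℝ := !![1, a, b; a, 1, c; b, c, 1]

/-- The quadratic form of `gram2 u` at `(x, y)` (plumbing for (a63): `tr A†A ≥ 0`). [folklore] -/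
private theorem gram2_quadForm (u x y : ℝ) :
    star ![x, y] ⬝ᵥ (gram2 u *ᵥ ![x, y]) = x ^ 2 + y ^ 2 + 2 * u * x * y := by
  simp [gram2, Matrix.mulVec, dotProduct, Fin.sum_univ_two]
  ring

/-- The quadratic form of `gram3 a b c` at `(x, y, z)` (plumbing for (a63): `tr A†A ≥ 0`). [folklore] -/
private theorem gram3_quadForm (a b c x y z : ℝ) :
    star ![x, y, z] ⬝ᵥ (gram3 a b c *ᵥ ![x, y, z]) =
      x ^ 2 + y ^ 2 + z ^ 2 + 2 * a * x * y + 2 * b * x * z + 2 * c * y * z := by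
  simp [gram3, Matrix.mulVec, dotProduct, Fin.sum_univ_three]
  ring

/-- **(a67)** `[[1, u],[u, 1]] ⪰ 0 ⇒ |u| ≤ 1` (AK: *"`|u|² ≤ 1`, as expected"*).
[cite: AndersonKruczenski2017, §4.2 eq. (a67)] -/
theorem abs_le_one_of_gram2 {u : ℝ} (h : (gram2 u).PosSemidef) : |u| ≤ 1 := by
  have h1 := h.dotProduct_mulVec_nonneg ![1, -1]
  have h2 := h.dotProduct_mulVec_nonneg ![1, 1]
  rw [gram2_quadForm] at h1 h2
  rw [abs_le]
  constructor <;> nlinarith [h1, h2]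

/-- The determinant of the `3 × 3` `ρ`-matrix: `det ρ = 1 − a² − b² − c² + 2abc` — the quantity whose
non-negativity is the printed inequality (a64). [cite: AndersonKruczenski2017, §4.2 eq. (a64) (its determinant form)] -/
theorem gram3_det (a b c : ℝ) : (gram3 a b c).det = 1 - a ^ 2 - b ^ 2 - c ^ 2 + 2 * a * b * c := by
  unfold gram3
  rw [Matrix.det_fin_three]
  simp
  ring

/-- **(a64)** `[[1, 𝒲_a, 𝒲_b],[𝒲_a, 1, 𝒲_c],[𝒲_b, 𝒲_c, 1]] ⪰ 0 ⇒ (𝒲_a − 𝒲_b)² ≤ (1 − 𝒲_c)(1 + 𝒲_c − 2𝒲_a𝒲_b)`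
(the printed right-hand inequality; it is `det ≥ 0` rearranged — the printed left-hand `0 ≤ (𝒲_a − 𝒲_b)²` is a
square).  AK: *"In particular, if `a` is a plaquette, `c` is any loop that appears in the Laplacian of `b`, namely in
the loop equation for `b`."* [cite: AndersonKruczenski2017, §4.2 eq. (a64)] -/
theorem sq_sub_le_of_gram3 {a b c : ℝ} (h : (gram3 a b c).PosSemidef) :
    (a - b) ^ 2 ≤ (1 - c) * (1 + c - 2 * a * b) := by
  have hd : 0 ≤ (gram3 a b c).det := h.det_nonneg
  rw [gram3_det] at hd
  have key : (1 - c) * (1 + c - 2 * a * b) - (a - b) ^ 2 = 1 - a ^ 2 - b ^ 2 - c ^ 2 + 2 * a * b * c := by ring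
  linarith [key, hd]

/-- Every off-diagonal entry of a positive semi-definite `ρ`-matrix with unit diagonal is `≤ 1` (test vector
`(0, 1, −1)`): the "maximum value" `1` of a loop used in (a69). [cite: AndersonKruczenski2017, §4.2 eqs. (a63), (a67); §4.3 ("their maximum values")] -/
theorem le_one_of_gram3 {a b c : ℝ} (h : (gram3 a b c).PosSemidef) : c ≤ 1 := by
  have h1 := h.dotProduct_mulVec_nonneg ![0, 1, -1]
  rw [gram3_quadForm] at h1
  nlinarith [h1]

/-- The first off-diagonal entry of a positive semi-definite `gram3` is `≤ 1` in absolute value (test vectors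
`(1, ∓1, 0)`). [cite: AndersonKruczenski2017, §4.2 eqs. (a63), (a67)] -/
theorem abs_le_one_of_gram3 {a b c : ℝ} (h : (gram3 a b c).PosSemidef) : |a| ≤ 1 := by
  have h1 := h.dotProduct_mulVec_nonneg ![1, -1, 0]
  have h2 := h.dotProduct_mulVec_nonneg ![1, 1, 0]
  rw [gram3_quadForm] at h1 h2
  rw [abs_le]
  constructor <;> nlinarith [h1, h2]

/-- **(a66)** For a loop `c` *"made out of two plaquettes connected by a [possibly empty] path"* — the `ρ`-matrix of
the three lines {trivial, `P₁⁻¹`, path·`P₂`} based at the junction is `gram3 u u 𝒲_c` — positivity gives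
`𝒲_c ≥ 2u² − 1` (test vector `(2u, −1, −1)`, whose quadratic form is `2(1 + 𝒲_c − 2u²)`).  AK: *"This means that,
if the expectation value of the plaquette is close to one, there are arbitrary long loops that are also close to
one."*  Used in (a69) as the "minimum value" of `𝒲₁₇, 𝒲₂₀, 𝒲₂₁` (resp. of `𝒲₂, 𝒲₃` in (a71)).
[cite: AndersonKruczenski2017, §4.2 eq. (a66)] -/
theorem two_mul_sq_sub_one_le_of_gram3 {u c : ℝ} (h : (gram3 u u c).PosSemidef) : 2 * u ^ 2 - 1 ≤ c := by
  have h1 := h.dotProduct_mulVec_nonneg ![2 * u, -1, -1]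
  rw [gram3_quadForm] at h1
  nlinarith [h1]

/-! ## §4. The analytic plaquette bounds (a69)–(a71) -/

/-- **`u_max`** as printed: `u_max(d, λ) = ½(−λ/(2(d−1)) + √(4 + λ²/(4(d−1)²)))`, the larger root of
`u² + λu/(2(d−1)) − 1 = 0` (a69). [cite: AndersonKruczenski2017, §4.3 eq. (a70)] -/
def uMax (d : ℕ) (lam : ℝ) : ℝ :=
  (1 / 2) * (-(lam / (2 * ((d : ℝ) - 1))) + Real.sqrt (4 + lam ^ 2 / (4 * ((d : ℝ) - 1) ^ 2)))

/-- **`u_min`** as printed: `u_min(d, λ) = ½(λ/(2d−3) − √(4 + (λ/(2d−3))²))`, the smaller root of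
`u² − λu/(2d−3) − 1 = 0`. [cite: AndersonKruczenski2017, §4.3 eq. (a71)] -/
def uMin (d : ℕ) (lam : ℝ) : ℝ :=
  (1 / 2) * (lam / (2 * (d : ℝ) - 3) - Real.sqrt (4 + (lam / (2 * (d : ℝ) - 3)) ^ 2))

/-- The `d = 4` upper bound: `u_max(4, λ) = ½(−λ/6 + √(4 + λ²/36))`. [cite: AndersonKruczenski2017, §4.3 eq. (a70)] -/
theorem uMax_four (lam : ℝ) : uMax 4 lam = (1 / 2) * (-(lam / 6) + Real.sqrt (4 + lam ^ 2 / 36)) := by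
  unfold uMax
  norm_num

/-- The `d = 4` lower bound: `u_min(4, λ) = ½(λ/5 − √(4 + (λ/5)²))`. [cite: AndersonKruczenski2017, §4.3 eq. (a71)] -/
theorem uMin_four (lam : ℝ) : uMin 4 lam = (1 / 2) * (lam / 5 - Real.sqrt (4 + (lam / 5) ^ 2)) := by
  unfold uMin
  norm_num

/-- Roots of `x² + px − 1`: if `x² + px − 1 ≤ 0` then `x ≤ (−p + √(p² + 4))/2`. [folklore] -/
private theorem le_root_of_quad_nonpos {p x : ℝ} (h : x ^ 2 + p * x - 1 ≤ 0) :
    x ≤ (-p + Real.sqrt (p ^ 2 + 4)) / 2 := by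
  set s := Real.sqrt (p ^ 2 + 4) with hs
  have hs2 : s ^ 2 = p ^ 2 + 4 := by
    rw [hs, Real.sq_sqrt (by positivity)]
  have hs0 : 0 ≤ s := Real.sqrt_nonneg _
  by_contra hlt
  push Not at hlt
  have h1 : 0 < x - (-p + s) / 2 := by linarith
  have h2 : 0 < x - (-p - s) / 2 := by linarith
  have hprod := mul_pos h1 h2
  nlinarith [hprod, hs2]

/-- Roots of `x² − qx − 1`: if `x² − qx − 1 ≤ 0` then `(q − √(q² + 4))/2 ≤ x`. [folklore] -/
private theorem root_le_of_quad_nonpos {q x : ℝ} (h : x ^ 2 - q * x - 1 ≤ 0) :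
    (q - Real.sqrt (q ^ 2 + 4)) / 2 ≤ x := by
  set s := Real.sqrt (q ^ 2 + 4) with hs
  have hs2 : s ^ 2 = q ^ 2 + 4 := by
    rw [hs, Real.sq_sqrt (by positivity)]
  have hs0 : 0 ≤ s := Real.sqrt_nonneg _
  by_contra hlt
  push Not at hlt
  have h1 : 0 < (q - s) / 2 - x := by linarith
  have h2 : 0 < (q + s) / 2 - x := by linarith
  have hprod := mul_pos h1 h2
  nlinarith [hprod, hs2]

/-- **AK's upper bound (a69)–(a70), PROVED as a finite implication.**  If real numbers satisfy the plaquette loop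
equation (a68) in dimension `d ≥ 2` and the substituted extreme values hold as inequalities — `𝒲₂ ≤ 1`, `𝒲₃ ≤ 1`
(their "maximum values") and `𝒲₁₇, 𝒲₂₀, 𝒲₂₁ ≥ 2u² − 1` (their "minimum values", (a66)) — then
`2λu ≤ 4(d−1)(1 − u²)`, i.e. `u² + λu/(2(d−1)) − 1 ≤ 0`, whence `u ≤ u_max(d, λ)`.  No sign condition on `λ` is
needed for the algebra. [cite: AndersonKruczenski2017, §4.3 eqs. (a68)–(a70)] -/
theorem plaquette_le_uMax {d : ℕ} (hd : 2 ≤ d) {lam u W₂ W₃ W₁₇ W₂₀ W₂₁ : ℝ}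
    (hLE : PlaquetteLoopEq d lam u W₂ W₃ W₁₇ W₂₀ W₂₁)
    (h₂ : W₂ ≤ 1) (h₃ : W₃ ≤ 1) (h₁₇ : 2 * u ^ 2 - 1 ≤ W₁₇) (h₂₀ : 2 * u ^ 2 - 1 ≤ W₂₀)
    (h₂₁ : 2 * u ^ 2 - 1 ≤ W₂₁) : u ≤ uMax d lam := by
  have hd2 : (2 : ℝ) ≤ (d : ℝ) := by exact_mod_cast hd
  have hdm2 : (0 : ℝ) ≤ 2 * ((d : ℝ) - 2) := by linarith
  have hd1 : (0 : ℝ) < (d : ℝ) - 1 := by linarith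
  unfold PlaquetteLoopEq at hLE
  have e3 : 2 * ((d : ℝ) - 2) * W₃ ≤ 2 * ((d : ℝ) - 2) * 1 := mul_le_mul_of_nonneg_left h₃ hdm2
  have e21 : 2 * ((d : ℝ) - 2) * (2 * u ^ 2 - 1) ≤ 2 * ((d : ℝ) - 2) * W₂₁ :=
    mul_le_mul_of_nonneg_left h₂₁ hdm2
  -- (a69): 2λu ≤ 4(d-1)(1-u²)
  have key : 4 * ((d : ℝ) - 1) * u ^ 2 + 2 * lam * u - 4 * ((d : ℝ) - 1) ≤ 0 := by nlinarith
  have hne : (2 * ((d : ℝ) - 1)) ≠ 0 := by positivity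
  have quad : u ^ 2 + (lam / (2 * ((d : ℝ) - 1))) * u - 1 ≤ 0 := by
    have hrepr : u ^ 2 + (lam / (2 * ((d : ℝ) - 1))) * u - 1 =
        (4 * ((d : ℝ) - 1) * u ^ 2 + 2 * lam * u - 4 * ((d : ℝ) - 1)) / (4 * ((d : ℝ) - 1)) := by
      field_simp
      ring
    rw [hrepr]
    exact div_nonpos_iff.mpr (Or.inr ⟨key, by linarith⟩)
  have hroot := le_root_of_quad_nonpos quad
  have hsq : (lam / (2 * ((d : ℝ) - 1))) ^ 2 + 4 = 4 + lam ^ 2 / (4 * ((d : ℝ) - 1) ^ 2) := by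
    field_simp
    ring
  rw [hsq] at hroot
  unfold uMax
  linarith

/-- **AK's lower bound (a71), PROVED as a finite implication.**  If real numbers satisfy the plaquette loop equation
(a68) in dimension `d ≥ 2` with `𝒲₂, 𝒲₃ ≥ 2u² − 1` ((a66), their "minimum values") and `𝒲₁₇, 𝒲₂₀, 𝒲₂₁ ≤ 1`,
then `2λu ≥ 2(2d−3)(u² − 1)`, i.e. `u² − λu/(2d−3) − 1 ≤ 0`, whence `u_min(d, λ) ≤ u`.
[cite: AndersonKruczenski2017, §4.3 eqs. (a68), (a71)] -/
theorem uMin_le_plaquette {d : ℕ} (hd : 2 ≤ d) {lam u W₂ W₃ W₁₇ W₂₀ W₂₁ : ℝ}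
    (hLE : PlaquetteLoopEq d lam u W₂ W₃ W₁₇ W₂₀ W₂₁)
    (h₂ : 2 * u ^ 2 - 1 ≤ W₂) (h₃ : 2 * u ^ 2 - 1 ≤ W₃) (h₁₇ : W₁₇ ≤ 1) (h₂₀ : W₂₀ ≤ 1) (h₂₁ : W₂₁ ≤ 1) :
    uMin d lam ≤ u := by
  have hd2 : (2 : ℝ) ≤ (d : ℝ) := by exact_mod_cast hd
  have hdm2 : (0 : ℝ) ≤ 2 * ((d : ℝ) - 2) := by linarith
  have hq : (0 : ℝ) < 2 * (d : ℝ) - 3 := by linarith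
  unfold PlaquetteLoopEq at hLE
  have e3 : 2 * ((d : ℝ) - 2) * (2 * u ^ 2 - 1) ≤ 2 * ((d : ℝ) - 2) * W₃ := mul_le_mul_of_nonneg_left h₃ hdm2
  have e21 : 2 * ((d : ℝ) - 2) * W₂₁ ≤ 2 * ((d : ℝ) - 2) * 1 := mul_le_mul_of_nonneg_left h₂₁ hdm2
  -- 2λu ≥ 2(2d-3)(u²-1)
  have key : 2 * (2 * (d : ℝ) - 3) * u ^ 2 - 2 * lam * u - 2 * (2 * (d : ℝ) - 3) ≤ 0 := by nlinarith
  have hne : (2 * (d : ℝ) - 3) ≠ 0 := ne_of_gt hq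
  have quad : u ^ 2 - (lam / (2 * (d : ℝ) - 3)) * u - 1 ≤ 0 := by
    have hrepr : u ^ 2 - (lam / (2 * (d : ℝ) - 3)) * u - 1 =
        (2 * (2 * (d : ℝ) - 3) * u ^ 2 - 2 * lam * u - 2 * (2 * (d : ℝ) - 3)) / (2 * (2 * (d : ℝ) - 3)) := by
      field_simp
    rw [hrepr]
    exact div_nonpos_iff.mpr (Or.inr ⟨key, by linarith⟩)
  have hroot := root_le_of_quad_nonpos quad
  have hsq : (lam / (2 * (d : ℝ) - 3)) ^ 2 + 4 = 4 + (lam / (2 * (d : ℝ) - 3)) ^ 2 := by ring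
  rw [hsq] at hroot
  unfold uMin
  linarith

/-- **Upper bound from the loop equation and `ρ`-matrix positivity** (AK §4.3 as they argue it): the plaquette loop
equation (a68) together with positivity of the `ρ`-matrices `[[1,𝒲₂],[𝒲₂,1]]`, `[[1,𝒲₃],[𝒲₃,1]]` ((a67): maximum
value `1`) and `gram3 u u 𝒲` for `𝒲 ∈ {𝒲₁₇, 𝒲₂₀, 𝒲₂₁}` ((a66): minimum value `2u² − 1`) forces `u ≤ u_max(d, λ)`.
AK: *"This calculation is simply an illustration that there is indeed a bound that follows from positivity of `ρ` and
the loop equation."* [cite: AndersonKruczenski2017, §4.3 eqs. (a68)–(a70); §4.2 eqs. (a63), (a66), (a67)] -/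
theorem plaquette_le_uMax_of_gram {d : ℕ} (hd : 2 ≤ d) {lam u W₂ W₃ W₁₇ W₂₀ W₂₁ : ℝ}
    (hLE : PlaquetteLoopEq d lam u W₂ W₃ W₁₇ W₂₀ W₂₁)
    (g₂ : (gram2 W₂).PosSemidef) (g₃ : (gram2 W₃).PosSemidef) (g₁₇ : (gram3 u u W₁₇).PosSemidef)
    (g₂₀ : (gram3 u u W₂₀).PosSemidef) (g₂₁ : (gram3 u u W₂₁).PosSemidef) : u ≤ uMax d lam :=
  plaquette_le_uMax hd hLE (abs_le.mp (abs_le_one_of_gram2 g₂)).2 (abs_le.mp (abs_le_one_of_gram2 g₃)).2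
    (two_mul_sq_sub_one_le_of_gram3 g₁₇) (two_mul_sq_sub_one_le_of_gram3 g₂₀)
    (two_mul_sq_sub_one_le_of_gram3 g₂₁)

/-- **Lower bound from the loop equation and `ρ`-matrix positivity**: (a68) with `gram3 u u 𝒲₂`, `gram3 u u 𝒲₃`
positive semi-definite ((a66)) and `[[1,𝒲],[𝒲,1]] ⪰ 0` for `𝒲 ∈ {𝒲₁₇, 𝒲₂₀, 𝒲₂₁}` ((a67)) forces `u_min(d, λ) ≤ u`.
[cite: AndersonKruczenski2017, §4.3 eqs. (a68), (a71); §4.2 eqs. (a63), (a66), (a67)] -/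
theorem uMin_le_plaquette_of_gram {d : ℕ} (hd : 2 ≤ d) {lam u W₂ W₃ W₁₇ W₂₀ W₂₁ : ℝ}
    (hLE : PlaquetteLoopEq d lam u W₂ W₃ W₁₇ W₂₀ W₂₁)
    (g₂ : (gram3 u u W₂).PosSemidef) (g₃ : (gram3 u u W₃).PosSemidef) (g₁₇ : (gram2 W₁₇).PosSemidef)
    (g₂₀ : (gram2 W₂₀).PosSemidef) (g₂₁ : (gram2 W₂₁).PosSemidef) : uMin d lam ≤ u :=
  uMin_le_plaquette hd hLE (two_mul_sq_sub_one_le_of_gram3 g₂) (two_mul_sq_sub_one_le_of_gram3 g₃)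
    (abs_le.mp (abs_le_one_of_gram2 g₁₇)).2 (abs_le.mp (abs_le_one_of_gram2 g₂₀)).2
    (abs_le.mp (abs_le_one_of_gram2 g₂₁)).2

/-- `u_max(d, λ) > 0` for every `d` and `λ` (the larger root of `x² + px − 1` is positive).
[cite: AndersonKruczenski2017, §4.3 eq. (a70) (sanity of the printed closed form)] -/
theorem uMax_pos (d : ℕ) (lam : ℝ) : 0 < uMax d lam := by
  unfold uMax
  set p := lam / (2 * ((d : ℝ) - 1)) with hp
  have hsq : 4 + lam ^ 2 / (4 * ((d : ℝ) - 1) ^ 2) = p ^ 2 + 4 := by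
    rw [hp, div_pow]
    ring
  rw [hsq]
  have h1 : |p| < Real.sqrt (p ^ 2 + 4) := by
    rw [← Real.sqrt_sq_eq_abs]
    exact Real.sqrt_lt_sqrt (sq_nonneg _) (by linarith)
  have h2 : p ≤ |p| := le_abs_self p
  linarith

/-- `u_max(d, λ) < 1` for `d ≥ 2` and `λ > 0` — AK: *"for `λ → 0`, `u_max ≃ 1 − λ/(4(d−1))`"*: the bound is
non-trivial at every positive coupling. [cite: AndersonKruczenski2017, §4.3 eq. (a70) and the sentence after it] -/
theorem uMax_lt_one {d : ℕ} (hd : 2 ≤ d) {lam : ℝ} (hlam : 0 < lam) : uMax d lam < 1 := by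
  unfold uMax
  have hd2 : (2 : ℝ) ≤ (d : ℝ) := by exact_mod_cast hd
  have hd1 : (0 : ℝ) < 2 * ((d : ℝ) - 1) := by linarith
  set p := lam / (2 * ((d : ℝ) - 1)) with hp
  have hp0 : 0 < p := by rw [hp]; exact div_pos hlam hd1
  have hsq : 4 + lam ^ 2 / (4 * ((d : ℝ) - 1) ^ 2) = p ^ 2 + 4 := by
    rw [hp, div_pow]
    ring
  rw [hsq]
  -- √(p²+4) < p + 2 since (p+2)² = p² + 4 + 4p > p² + 4
  have h1 : Real.sqrt (p ^ 2 + 4) < p + 2 := by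
    rw [Real.sqrt_lt' (by linarith)]
    nlinarith
  linarith

/-- `u_min(d, λ) < 0` for every `d` and `λ`: the printed analytic lower bound (a71) is a negative number (weaker than
the SDP value `u_min = 0` AK report at `L_max = 8, 10`, *"a correct but rather poor bound"*).
[cite: AndersonKruczenski2017, §4.3 eq. (a71); §4.4] -/
theorem uMin_neg (d : ℕ) (lam : ℝ) : uMin d lam < 0 := by
  unfold uMin
  set q := lam / (2 * (d : ℝ) - 3) with hq
  have h1 : |q| < Real.sqrt (4 + q ^ 2) := by
    rw [← Real.sqrt_sq_eq_abs]
    exact Real.sqrt_lt_sqrt (sq_nonneg _) (by linarith)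
  have h2 : q ≤ |q| := le_abs_self q
  linarith

/-! ## §5 (v1.1, append-only). The two-dimensional planar system of AK §3: the loop equation, its strong-coupling
solution, the Toeplitz `ρ`-matrix and «`u = 1` ⇒ all loops are `1`» — folded from ym-lit-type-7's unfiled draft

This section FOLDS the residuals of the parallel draft `run/shared/lean/pub/lit-balaban/ym-lit-type-7/drafts/
AK2017-LoopEquationBootstrap.rc0.lean` (sha16 198df3dca41ee3d3; seat literature-prover-ym-lit-type-7-g0-0, R141 (D),
2026-08-26; not filed because this module landed first) into this file's vocabulary, append-only (every v1 declaration
above is byte-identical).  Printed text (corpus chunks p0007–p0008 of `paper:arxiv-1612.08140`), verbatim: §3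
*"In axial gauge … the two dimensional case reduces to the single plaquette … 𝒲_n = (1/N)⟨tr Uⁿ⟩ … The result for the
plaquette (and therefore the energy) is 𝒲₁ = u = 1 − λ/2 (λ ≤ 1), 1/(2λ) (λ ≥ 1)"*; §3.1 *"Take A = Σ_{n=0}^L c_nUⁿ ⇒
Σ_{n,m=0}^L c̄_n c_m 𝒲_{|n−m|} ≥ 0 ∀c_n … ρ^{(L)} = (1/L)[𝒲_{|i−j|}]_{i,j=0..L} ⪰ 0 … ρ^{(L)}_{ij} = (1/L)𝕋[𝒲₀,…,𝒲_L]_{ij}"*,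
*"the bound for ρ^{(L=2)} is |u| ≤ 1 and when we saturate it (u = 1) we are able to compute all Wilson loops obtaining
𝒲_n = 1"*, and (rate of change) *"(𝒲_n − 𝒲_{n−1})² ≤ … since |1 + u − 2𝒲_n𝒲_{n−1}| ≤ 4 because each loop satisfies
|𝒲_p| ≤ 1"*; §3.3 *"the loop equations becomes simply 𝒲_{n+1} − 𝒲_{n−1} + 2λ𝒲_n + 2λΣ_{p=1}^{n−1}𝒲_p𝒲_{n−p} = 0, n > 0"*;
§3.2 *"Minimizing this action with respect to the 𝒲_n trivially gives 𝒲₁ = 1/(2λ), 𝒲_{n≥2} = 0, namely the strong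
coupling solution"*; §4.6 *"Using sdpa for loops up to length L = 12 we find for the plaquette w₁ ≥ 0.238 and for L = 14
w₁ ≥ 0.2495 in agreement with the value w₁ = ¼"*.  Everything below is a definition with a body or a PROVED statement;
0 new named facts. -/

/-- **The 2D planar loop equations** (hypothesis shape): a sequence `𝒲 : ℕ → ℝ` (`𝒲_n` = planar value of
`(1/N)tr Uⁿ`) with `𝒲₀ = 1` and, for every `n > 0`, *"`𝒲_{n+1} − 𝒲_{n−1} + 2λ𝒲_n + 2λΣ_{p=1}^{n−1} 𝒲_p𝒲_{n−p} = 0`"*.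
Nothing asserts that any lattice measure produces such a sequence. (Folded from ym-lit-type-7's draft.)
[cite: AndersonKruczenski2017, §3.3 (the 2D loop equation display, "n > 0")] -/
def LoopEq2D (lam : ℝ) (W : ℕ → ℝ) : Prop :=
  W 0 = 1 ∧ ∀ n : ℕ, 0 < n →
    W (n + 1) - W (n - 1) + 2 * lam * W n + 2 * lam * ∑ p ∈ Finset.Ioo 0 n, W p * W (n - p) = 0

/-- The `n = 1` equation: `𝒲₂ = 1 − 2λ𝒲₁` (*"if we give a value to 𝒲₁ = u, then all the other Wilson loops are fixed
recursively"*). [cite: AndersonKruczenski2017, §3.3 (sentence after the 2D loop equation)] -/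
theorem LoopEq2D.W_two {lam : ℝ} {W : ℕ → ℝ} (h : LoopEq2D lam W) : W 2 = 1 - 2 * lam * W 1 := by
  obtain ⟨h0, h⟩ := h
  have h1 := h 1 one_pos
  simp only [Nat.reduceAdd, tsub_self, h0] at h1
  have : Finset.Ioo 0 1 = (∅ : Finset ℕ) := by decide
  rw [this, Finset.sum_empty, mul_zero, add_zero] at h1
  linarith

/-- The PRINTED exact planar plaquette of the 2D theory (Gross–Witten ∕ Wadia ∕ Friedan): `u = 1 − λ/2` for `λ ≤ 1`,
`u = 1/(2λ)` for `λ ≥ 1` (comparator; same function as `KazakovZheng2023.gwPlaquette2D`).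
[cite: AndersonKruczenski2017, §3 (the display "𝒲₁ = u = 1 − λ/2 (λ ≤ 1), 1/(2λ) (λ ≥ 1)")] -/
def exactPlaquette2D (lam : ℝ) : ℝ := if lam ≤ 1 then 1 - lam / 2 else 1 / (2 * lam)

/-- The two printed branches agree at `λ = 1` (*"At λ = 1 there is a jump in the second derivative of 𝒲₁ and
therefore the transition is third order"* presupposes continuity). [cite: AndersonKruczenski2017, §3 (same display and the sentence after it)] -/
theorem exactPlaquette2D_one : exactPlaquette2D 1 = 1 / 2 := by norm_num [exactPlaquette2D]

/-- The printed STRONG-COUPLING SOLUTION of the 2D loop equations: `𝒲₀ = 1`, `𝒲₁ = 1/(2λ)`, `𝒲_{n≥2} = 0`.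
[cite: AndersonKruczenski2017, §3.2 ("trivially gives 𝒲₁ = 1/(2λ), 𝒲_{n≥2} = 0, namely the strong coupling solution")] -/
def gwStrong (lam : ℝ) (n : ℕ) : ℝ := if n = 0 then 1 else if n = 1 then 1 / (2 * lam) else 0

/-- **The strong-coupling solution satisfies the 2D planar loop equations exactly, for every `λ ≠ 0`** (PROVED; the
paper uses this implicitly — and notes that for `λ < 1` it violates positivity). (Folded from ym-lit-type-7's draft.)
[cite: AndersonKruczenski2017, §3.3 (2D loop equation) with §3.2 (strong coupling solution)] -/
theorem gwStrong_loopEq2D {lam : ℝ} (hlam : lam ≠ 0) : LoopEq2D lam (gwStrong lam) := by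
  refine ⟨by simp [gwStrong], fun n hn => ?_⟩
  rcases Nat.lt_or_ge n 3 with hlt | hge
  · interval_cases n
    · have hI : Finset.Ioo 0 1 = (∅ : Finset ℕ) := by decide
      have h2 : 2 * lam * (1 / (2 * lam)) = 1 := by field_simp
      simp only [gwStrong, hI, Finset.sum_empty, mul_zero, add_zero]
      norm_num
      linear_combination h2
    · have : Finset.Ioo 0 2 = ({1} : Finset ℕ) := by decide
      simp only [gwStrong, this, Finset.sum_singleton]
      simp
      field_simp
      ring
  · have hsum : ∑ p ∈ Finset.Ioo 0 n, gwStrong lam p * gwStrong lam (n - p) = 0 := by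
      refine Finset.sum_eq_zero fun p hp => ?_
      rw [Finset.mem_Ioo] at hp
      by_cases hp1 : p = 1
      · subst hp1
        have h2 : n - 1 ≠ 0 := by omega
        have h3 : n - 1 ≠ 1 := by omega
        simp [gwStrong, h2, h3]
      · have h2 : p ≠ 0 := by omega
        simp [gwStrong, hp1, h2]
    rw [hsum]
    have h3 : n - 1 ≠ 0 := by omega
    have h4 : n - 1 ≠ 1 := by omega
    have h5 : n ≠ 0 := by omega
    have h6 : n ≠ 1 := by omega
    simp [gwStrong, h3, h4, h5, h6]

/-- The strong-coupling solution has plaquette `1/(2λ)` = the `λ ≥ 1` branch of the exact answer.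
[cite: AndersonKruczenski2017, §3 (exact plaquette display), §3.2] -/
theorem gwStrong_one_eq_exactPlaquette2D {lam : ℝ} (h : 1 < lam) : gwStrong lam 1 = exactPlaquette2D lam := by
  simp [gwStrong, exactPlaquette2D, not_le.mpr h]

/-- The TOEPLITZ MATRIX `𝕋[𝒲₀,…,𝒲_L]_{ij} = 𝒲_{|i−j|}` of a loop sequence (`(L+1) × (L+1)`); the printed "Wilson-loop
density matrix" is `ρ^{(L)} = (1/L)𝕋[𝒲₀,…,𝒲_L]`, and its positive semi-definiteness is the printed constraint
*"Σ_{n,m=0}^L c̄_nc_m𝒲_{|n−m|} ≥ 0 ∀c_n"*. [cite: AndersonKruczenski2017, §3.1 (the displays defining ρ^{(L)} and "ρ^{(L)}_{ij} = (1/L)𝕋[𝒲₀,…,𝒲_L]_{ij} = (1/L)𝒲_{|i−j|}", TeX label (a32))] -/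
def toeplitz (W : ℕ → ℝ) (L : ℕ) : Matrix (Fin (L + 1)) (Fin (L + 1)) ℝ :=
  fun i j => W (Nat.dist i.val j.val)

/-- The printed density matrix `ρ^{(L)} = (1/L)·𝕋[𝒲₀,…,𝒲_L]` (*"Since 𝒲₀ = 1 then tr ρ = 1"* up to the printed
normalisation). [cite: AndersonKruczenski2017, §3.1 (the display defining ρ^{(L)})] -/
def rhoMatrix (W : ℕ → ℝ) (L : ℕ) : Matrix (Fin (L + 1)) (Fin (L + 1)) ℝ := ((L : ℝ)⁻¹) • toeplitz W L

/-- The diagonal of the Toeplitz matrix is `𝒲₀`. [cite: AndersonKruczenski2017, §3.1 (ρ^{(L)} display)] -/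
theorem toeplitz_diag (W : ℕ → ℝ) (L : ℕ) (i : Fin (L + 1)) : toeplitz W L i i = W 0 := by
  simp [toeplitz, Nat.dist_self]

/-- The Toeplitz matrix is symmetric. [cite: AndersonKruczenski2017, §3.1 (ρ^{(L)} display)] -/
theorem toeplitz_transpose (W : ℕ → ℝ) (L : ℕ) : (toeplitz W L).transpose = toeplitz W L := by
  ext i j
  simp [toeplitz, Nat.dist_comm]

/-- The printed RATE-OF-CHANGE bound: from (a64)-type positivity `(𝒲_n − 𝒲_{n−1})² ≤ (1 − u)(1 + u − 2𝒲_n𝒲_{n−1})`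
and `|u|, |𝒲_n|, |𝒲_{n−1}| ≤ 1` one gets `(𝒲_n − 𝒲_{n−1})² ≤ 4(1 − u)` (*"since |1 + u − 2𝒲_n𝒲_{n−1}| ≤ 4 because
each loop satisfies |𝒲_p| ≤ 1"*). PROVED. (Folded from ym-lit-type-7's draft.)
[cite: AndersonKruczenski2017, §3.1 (the bullet "an interesting inequality that bounds the rate of change")] -/
theorem sq_sub_le_four_mul {u a b : ℝ} (h : (a - b) ^ 2 ≤ (1 - u) * (1 + u - 2 * a * b))
    (hu : |u| ≤ 1) (ha : |a| ≤ 1) (hb : |b| ≤ 1) : (a - b) ^ 2 ≤ 4 * (1 - u) := by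
  rw [abs_le] at hu ha hb
  have h1 : 0 ≤ 1 - u := by linarith
  have h2 : 1 + u - 2 * a * b ≤ 4 := by nlinarith
  calc (a - b) ^ 2 ≤ (1 - u) * (1 + u - 2 * a * b) := h
    _ ≤ (1 - u) * 4 := mul_le_mul_of_nonneg_left h2 h1
    _ = 4 * (1 - u) := by ring

/-- The mechanism of *"if 𝒲₁ = u = 1 then all loops are equal 𝒲_n = 1 independently of the action!"*: with `u = 1`
the `3 × 3` `ρ`-matrix `gram3 1 a b` has determinant `−(a − b)²`, so positivity forces `a = b`. PROVED.
[cite: AndersonKruczenski2017, §3.1 (the bullet "if 𝒲₁ = u = 1 then all loops are equal"); §4.2 (the 2 × 2 example "if the plaquette is one (u = 1) then all loops are equal to one")] -/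
theorem eq_of_gram3_one {a b : ℝ} (h : (gram3 1 a b).PosSemidef) : a = b := by
  have hd : 0 ≤ (gram3 1 a b).det := h.det_nonneg
  rw [gram3_det] at hd
  nlinarith [sq_nonneg (a - b)]

/-- **«`u = 1` ⇒ all loops are `1`»**, the inductive statement: if `𝒲₀ = 1`, `𝒲₁ = 1` and every `ρ`-matrix
`gram3 𝒲₁ 𝒲_{n+1} 𝒲_n` (the `3 × 3` principal minor of `ρ^{(L)}` on the powers `0, 1, n+1`… as printed, rows
`(1, 𝒲₁, 𝒲_{n+1}; 𝒲₁, 1, 𝒲_n; 𝒲_{n+1}, 𝒲_n, 1)`) is positive semi-definite, then `𝒲_n = 1` for all `n`. PROVED by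
induction. (Folded from ym-lit-type-7's draft.) [cite: AndersonKruczenski2017, §3.1 ("we are able to compute all Wilson loops obtaining 𝒲_n = 1. This is generic.")] -/
theorem all_loops_one {W : ℕ → ℝ} (h0 : W 0 = 1) (h1 : W 1 = 1)
    (hpsd : ∀ n : ℕ, (gram3 (W 1) (W (n + 1)) (W n)).PosSemidef) (n : ℕ) : W n = 1 := by
  induction n with
  | zero => exact h0
  | succ k ih =>
    have hk := hpsd k
    rw [h1] at hk
    rw [eq_of_gram3_one hk, ih]

/-- PRINTED NUMERICS of the 4D weak-coupling expansion `𝒲_n = 1 − λw_n + …` (§4.6, floating-point SDP with sdpa;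
comparators, NOT certificates): the lower bounds `w₁ ≥ 0.238` at `L = 12` and `w₁ ≥ 0.2495` at `L = 14`, against the
exact one-loop value `w₁ = ¼`. [cite: AndersonKruczenski2017, §4.6 ("we find for the plaquette w₁ ≥ 0.238 and for L = 14 w₁ ≥ 0.2495 in agreement with the value w₁ = 1/4")] -/
def w1LowerBoundL12 : ℚ := 0.238

/-- The printed `L = 14` SDP lower bound `w₁ ≥ 0.2495` (floating point; comparator). [cite: AndersonKruczenski2017, §4.6 ("for L = 14 w₁ ≥ 0.2495")] -/
def w1LowerBoundL14 : ℚ := 0.2495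

/-- The exact one-loop coefficient `w₁ = ¼` quoted in §4.6 (from the 3-loop series (a7): `u = 1 − λ/4 − …`).
[cite: AndersonKruczenski2017, §4.6 ("the value w₁ = 1/4"); §2.1.2 eq. (a7)] -/
def w1Exact : ℚ := 1 / 4

/-- The printed SDP lower bounds are consistent with and increase towards the exact `¼`:
`0.238 < 0.2495 < ¼`. [cite: AndersonKruczenski2017, §4.6] -/
theorem w1_bounds_consistent : w1LowerBoundL12 < w1LowerBoundL14 ∧ w1LowerBoundL14 < w1Exact := by
  unfold w1LowerBoundL12 w1LowerBoundL14 w1Exact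
  norm_num

end Literature.MathematicalPhysics.QuantumFieldTheory.AndersonKruczenski2017

end
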